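import Literature.NumberTheory.Automorphic.CuspHeightIsometry

/-!
# Invariant integral operators on functions of the height: convolution in `log y` and the action on cusp lifts
(Iwaniec, *Spectral Methods of Automorphic Forms*, GSM 53, §1.8 Thm 1.16 (proof: the substitutions
`x = 2√(uy)`, `y = e^r`), §4.2 (4.12) `∫ k(z, n(t)z') dt = √(y'y) g(log(y'/y))` and "one should also
realize that `H_𝔞(z, w)` is an incomplete Eisenstein series in the second variable", the
Proposition on p. 49 (`(Lf)_𝔞 = L(f_𝔞)`); PDF pp. 24, 49, 51)

Second brick of the Eisenstein-free proof of the pretrace estimate (12.5)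
(`Literature.NumberTheory.Automorphic.Iwaniec2002_eq_12_5`), after `CuspHeightIsometry`. For a test
kernel `k` (bounded, measurable, compactly supported) with profile `g = selbergG k` of (1.62):

1. (§1) **(4.12) as an operator identity**: on a function of the height `w ↦ √(Im w) Ψ(log Im w)`
   (`Ψ` bounded measurable) the invariant integral operator `L_k` acts by the convolution with `g` in
   `v = log y`: `L_k(√y Ψ(log y))(z) = √(Im z) ∫ g(r) Ψ(log Im z + r) dr`
   (`invariantOperator_liftProfile`), i.e. `M_k = √y (g ⋆ Ψ)(log y)`.
2. (§2) the height operator `heightOp k φ (y) = L_k(φ ∘ Im)(iy)`, the profile convolution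
   `profileConv k Ψ (v) = ∫ g(r)Ψ(v + r) dr`, and **`L_k E_𝔞(·|φ) = E_𝔞(·|M_kφ)`** for locally
   bounded measurable profiles vanishing on `(-∞, Y]`, `Y > 0` (`invariantOperator_incEisCusp`;
   the book's Proposition on p. 49, `(Lf)_𝔞 = L(f_𝔞)`, for incomplete Eisenstein series): `L_k`
   commutes with the averaging over `Γ_𝔞\Γ` (locally a finite sum) and with the scaling, and maps
   functions of the height to functions of the height; on cusp lifts,
   `L_k(V_𝔞^{(Y)}Ψ) = V_𝔞^{(Y')}(g ⋆ Ψ)` for `Y' e^{R} ≤ Y` (`invariantOperator_cuspLift`).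
3. (§3) nice log-profiles (`IsNiceProfile`: bounded, measurable, supported in `(log Y, b]`) and the
   identity at the level of `L²(F)`: `T_k (V_𝔞^{(Y)} Ψ) = V_𝔞^{(Y')} (g ⋆ Ψ)` (`kernelCLM_cuspIsometry`).

Everything here is proved; nothing is vendored; no fact is introduced.

## References
* [Iwaniec2002] H. Iwaniec, *Spectral Methods of Automorphic Forms*, 2nd ed., GSM 53, AMS 2002,
  Thm 1.16 (proof), PDF p. 24; §4.2 (4.12) & p. 49, PDF pp. 49, 51
  (held copy `book:iwaniec2002-spectral-methods-automorphic-forms`).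
-/

noncomputable section

namespace Literature.NumberTheory.Automorphic

open Matrix UpperHalfPlane
open scoped MatrixGroups

namespace Fuchsian

variable {Γ : Subgroup (GL (Fin 2) ℝ)}

/-! ## 1. `L_k` on functions of the height: convolution with `g` in `log y` ((4.12)) -/

section HeightAction

open _root_.MeasureTheory _root_.Set _root_.Filter _root_.Convolution
open scoped _root_.Pointwise _root_.ENNReal _root_.Topology

variable {k : ℝ → ℝ}

/-- The height function `w ↦ √(Im w) Ψ(log Im w)` attached to a log-profile `Ψ` is locally integrable
on `ℍ` for bounded measurable `Ψ`. [folklore] -/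
theorem locallyIntegrable_liftProfile_comp_im {Ψ : ℝ → ℂ} (hΨm : Measurable Ψ) {B : ℝ} (hB : ∀ v, ‖Ψ v‖ ≤ B) :
    LocallyIntegrable fun w : ℍ => liftProfile 0 Ψ w.im := by
  rw [locallyIntegrable_iff]
  intro C hC
  obtain ⟨S, hS⟩ := hC.exists_bound_of_continuousOn (f := fun w : ℍ => Real.sqrt w.im)
    (Real.continuous_sqrt.comp UpperHalfPlane.continuous_im).continuousOn
  refine Measure.integrableOn_of_bounded (M := S * B) hC.measure_lt_top.ne
    ((measurable_liftProfile 0 hΨm).comp UpperHalfPlane.continuous_im.measurable).aestronglyMeasurable ?_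
  filter_upwards [ae_restrict_mem hC.measurableSet] with w hw
  rw [liftProfile_eq_of_lt Ψ w.im_pos, norm_mul, Complex.norm_real]
  have h1 := hS w hw
  rw [Real.norm_eq_abs, abs_of_nonneg (Real.sqrt_nonneg _)] at h1 ⊢
  exact mul_le_mul h1 (hB _) (norm_nonneg _) ((Real.sqrt_nonneg _).trans h1)

/-- The pointwise bookkeeping of the substitution `y = y₀ e^r` for a height function:
`(y₀e^r) · (y₀e^r)⁻² · √(y₀e^r)Ψ(log(y₀e^r)) · 2√(y₀ · y₀e^r) Q = √y₀ · Ψ(log y₀ + r) · (2Q)`. [folklore] -/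
theorem expSubst_liftProfile {y₀ : ℝ} (hy₀ : 0 < y₀) (Ψ : ℝ → ℂ) (Q r : ℝ) :
    (y₀ * Real.exp r) • ((((y₀ * Real.exp r) ^ 2)⁻¹ : ℝ) •
      (liftProfile 0 Ψ (y₀ * Real.exp r) * ((2 * Real.sqrt (y₀ * (y₀ * Real.exp r)) * Q : ℝ) : ℂ))) =
      ((Real.sqrt y₀ : ℝ) : ℂ) * (((2 * Q : ℝ) : ℂ) * Ψ (Real.log y₀ + r)) := by
  have hy : 0 < y₀ * Real.exp r := mul_pos hy₀ (Real.exp_pos r)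
  rw [liftProfile_eq_of_lt Ψ hy, Real.log_mul hy₀.ne' (Real.exp_pos r).ne', Real.log_exp,
    sqrt_mul_mul_exp hy₀, Real.sqrt_mul hy₀.le, Complex.real_smul, Complex.real_smul]
  have hsq : Real.sqrt (Real.exp r) = Real.exp (r / 2) := by
    rw [show Real.exp r = Real.exp (r / 2) ^ 2 by rw [← Real.exp_nat_mul]; ring_nf, Real.sqrt_sq (Real.exp_pos _).le]
  rw [hsq]
  have hE : Real.exp r = Real.exp (r / 2) * Real.exp (r / 2) := by rw [← Real.exp_add]; ring_nf
  have hy0 : (y₀ : ℂ) ≠ 0 := by exact_mod_cast hy₀.ne'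
  have he0 : (Real.exp (r / 2) : ℂ) ≠ 0 := by exact_mod_cast (Real.exp_pos _).ne'
  rw [hE]
  push_cast
  field_simp

/-- **(4.12): `L_k` acts on functions of the height by the convolution with `g` in `log y`.** For a
test kernel `k` and a bounded measurable log-profile `Ψ`,
`L_k(w ↦ √(Im w) Ψ(log Im w))(z) = √(Im z) · ∫ g(r) Ψ(log Im z + r) dr` with `g = selbergG k`
(Iwaniec's `∫ k(z, n(t)z') dt = √(y'y) g(log(y'/y))`, integrated against `Ψ`; proof as for
Theorem 1.16: coordinates, the fibre integral `x = 2√(uy)`, and `y = (Im z) e^r`).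
[cite: Iwaniec2002, §4.2 (4.12), PDF p. 51; Thm 1.16 (proof), PDF p. 24] -/
theorem invariantOperator_liftProfile (hk : IsTestKernel k) {Ψ : ℝ → ℂ} (hΨm : Measurable Ψ)
    {B : ℝ} (hB : ∀ v, ‖Ψ v‖ ≤ B) (z : ℍ) :
    invariantOperator k (fun w : ℍ => liftProfile 0 Ψ w.im) z =
      ((Real.sqrt z.im : ℝ) : ℂ) * ∫ r : ℝ, ((selbergG k r : ℝ) : ℂ) * Ψ (Real.log z.im + r) := by
  have hz := z.im_pos
  set F : ℍ → ℂ := fun w => (k (pointPairInv z w) : ℂ) * liftProfile 0 Ψ w.im with hF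
  set G : ℂ → ℂ := fun p => ((p.im ^ 2)⁻¹ : ℝ) •
    ((k (((p.re - z.re) ^ 2 + (p.im - z.im) ^ 2) / (4 * z.im * p.im)) : ℂ) * liftProfile 0 Ψ p.im) with hG
  have hFG : ∀ p ∈ {p : ℂ | 0 < p.im}, ((p.im ^ 2)⁻¹ : ℝ) • F (ofComplex p) = G p := by
    intro p hp
    have hp' : 0 < p.im := hp
    simp only [hF, hG, pointPairInv_ofComplex z hp']
    rw [ofComplex_apply_of_im_pos hp']
    rfl
  have hFi : Integrable F := integrable_kernel_mul hk (locallyIntegrable_liftProfile_comp_im hΨm hB) z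
  have hGi : IntegrableOn G {p : ℂ | 0 < p.im} :=
    ((integrable_upperHalfPlane_iff_integrableOn_complex F).mp hFi).congr_fun hFG
      (isOpen_upperHalfPlaneSet.measurableSet)
  unfold invariantOperator
  rw [show (fun w : ℍ => (k (pointPairInv z w) : ℂ) * liftProfile 0 Ψ w.im) = F from rfl,
    integral_upperHalfPlane_eq_integral_complex F,
    setIntegral_congr_fun isOpen_upperHalfPlaneSet.measurableSet hFG,
    setIntegral_upperHalf_eq_iterated G hGi]
  -- the fibre integrals
  have hfib : ∀ y ∈ Ioi (0 : ℝ), ∫ x : ℝ, G ⟨x, y⟩ = ((y ^ 2)⁻¹ : ℝ) • (liftProfile 0 Ψ y *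
      ((2 * Real.sqrt (z.im * y) * selbergQ k ((y - z.im) ^ 2 / (4 * z.im * y)) : ℝ) : ℂ)) := by
    intro y hy
    have hy' : 0 < y := hy
    simp only [hG]
    rw [integral_smul]
    simp_rw [mul_comm ((k _ : ℝ) : ℂ) (liftProfile 0 Ψ y)]
    rw [integral_const_mul, integral_complex_ofReal, integral_kernel_fibre k hz hy']
  rw [setIntegral_congr_fun measurableSet_Ioi hfib, integral_Ioi_expSubst hz, ← integral_const_mul]
  congr 1 with r
  rw [expSubst_liftProfile hz Ψ _ r, expSubst_arg hz]
  rfl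

/-- The profile integral as a convolution: `∫ g(r) Ψ(v + r) dr = (g ⋆ Ψ)(v)` (`g` is even).
[cite: Iwaniec2002, §4.2 (4.12), PDF p. 51] -/
theorem integral_selbergG_mul_eq_convolution (k : ℝ → ℝ) (Ψ : ℝ → ℂ) (v : ℝ) :
    ∫ r : ℝ, ((selbergG k r : ℝ) : ℂ) * Ψ (v + r) =
      ((fun r => ((selbergG k r : ℝ) : ℂ)) ⋆[ContinuousLinearMap.mul ℂ ℂ] Ψ) v := by
  rw [convolution_def]
  simp only [ContinuousLinearMap.mul_apply']
  rw [← integral_neg_eq_self]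
  refine integral_congr_ae (Eventually.of_forall fun r => ?_)
  simp only
  rw [selbergG_neg, ← sub_eq_add_neg]

end HeightAction

/-! ## 2. The profile convolution and `L_k E_𝔞(·|φ) = E_𝔞(·|M_k φ)` -/

section IncEisAction

open _root_.MeasureTheory _root_.Set _root_.Filter
open scoped _root_.Pointwise _root_.ENNReal _root_.Topology

variable {k : ℝ → ℝ}

/-- **The profile convolution** `(g ⋆ Ψ)(v) = ∫ g(r) Ψ(v + r) dr` of a log-profile with the profile
`g = selbergG k` of a test kernel: the action of `L_k` on functions of the height, (4.12), in the
variable `v = log y`. [cite: Iwaniec2002, §4.2 (4.12), PDF p. 51] -/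
def profileConv (k : ℝ → ℝ) (Ψ : ℝ → ℂ) (v : ℝ) : ℂ := ∫ r : ℝ, ((selbergG k r : ℝ) : ℂ) * Ψ (v + r)

/-- The profile convolution is measurable (bounded measurable `Ψ`, test kernel `k`). [folklore] -/
theorem measurable_profileConv (hk : IsTestKernel k) {Ψ : ℝ → ℂ} (hΨm : Measurable Ψ) :
    Measurable (profileConv k Ψ) := by
  have hG : Measurable fun r : ℝ => ((selbergG k r : ℝ) : ℂ) :=
    Complex.measurable_ofReal.comp (measurable_selbergG hk.measurable)
  have hunc : Measurable (Function.uncurry fun (v r : ℝ) => ((selbergG k r : ℝ) : ℂ) * Ψ (v + r)) :=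
    (hG.comp measurable_snd).mul (hΨm.comp (measurable_fst.add measurable_snd))
  exact (hunc.stronglyMeasurable.integral_prod_right (ν := (volume : Measure ℝ))).measurable

/-- The profile convolution is bounded: `|(g ⋆ Ψ)(v)| ≤ (∫ |g|) sup |Ψ|`. [folklore] -/
theorem norm_profileConv_le (hk : IsTestKernel k) {Ψ : ℝ → ℂ} {B : ℝ}
    (hB : ∀ v, ‖Ψ v‖ ≤ B) (v : ℝ) : ‖profileConv k Ψ v‖ ≤ (∫ r : ℝ, |selbergG k r|) * B := by
  obtain ⟨M, hM0, hM⟩ := hk.eventually_zero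
  obtain ⟨Bk, hBk⟩ := hk.bounded
  have hgi : Integrable (selbergG k) := by
    have := integrable_mul_selbergG hk.measurable hBk hM hM0 (φ := fun _ => (1 : ℝ)) continuous_const
    simpa using this
  unfold profileConv
  calc ‖∫ r : ℝ, ((selbergG k r : ℝ) : ℂ) * Ψ (v + r)‖ ≤ ∫ r : ℝ, |selbergG k r| * B := by
        refine norm_integral_le_of_norm_le (hgi.norm.mul_const B) (Eventually.of_forall fun r => ?_)
        rw [norm_mul, Complex.norm_real, Real.norm_eq_abs]
        exact mul_le_mul_of_nonneg_left (hB _) (abs_nonneg _)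
    _ = (∫ r : ℝ, |selbergG k r|) * B := integral_mul_const _ _

/-- **Support of the profile convolution**: if `Ψ = 0` on `(-∞, a]` and `k = 0` on `[M, ∞)` then
`g ⋆ Ψ = 0` on `(-∞, a - 2 arsinh √M]`. [folklore] -/
theorem profileConv_eq_zero {M : ℝ} (hM : ∀ u, M ≤ u → k u = 0) (hM0 : 0 ≤ M) {Ψ : ℝ → ℂ} {a : ℝ}
    (hΨ : ∀ v ≤ a, Ψ v = 0) {v : ℝ} (hv : v ≤ a - 2 * Real.arsinh (Real.sqrt M)) : profileConv k Ψ v = 0 := by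
  unfold profileConv
  refine integral_eq_zero_of_ae (Eventually.of_forall fun r => ?_)
  simp only [Pi.zero_apply]
  by_cases hr : 2 * Real.arsinh (Real.sqrt M) ≤ |r|
  · rw [selbergG_eq_zero hM hM0 hr]; simp
  · rw [hΨ (v + r) (by linarith [le_abs_self r, not_le.mp hr])]; simp

/-- A log-profile vanishing on `(-∞, log Y]` lifts in the same way above every level in `[0, Y]`. [folklore] -/
theorem liftProfile_eq_liftProfile_zero {Y : ℝ} (hY : 0 ≤ Y) {Ψ : ℝ → ℂ} (hΨ : ∀ v ≤ Real.log Y, Ψ v = 0) :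
    liftProfile Y Ψ = liftProfile 0 Ψ := by
  funext y
  by_cases hy : Y < y
  · rw [liftProfile_eq_of_lt Ψ hy, liftProfile_eq_of_lt Ψ (lt_of_le_of_lt hY hy)]
  · rw [liftProfile_eq_zero_of_le Ψ (not_lt.mp hy)]
    by_cases hy0 : 0 < y
    · rw [liftProfile_eq_of_lt Ψ hy0, hΨ _ (Real.log_le_log hy0 (not_lt.mp hy)), mul_zero]
    · rw [liftProfile_eq_zero_of_le Ψ (not_lt.mp hy0)]

/-- **The height operator** `(M_k φ)(y) = L_k(φ ∘ Im)(iy)` for `y > 0` (and `0` for `y ≤ 0`): the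
action of the invariant integral operator on functions of the height ((4.12)). [cite: Iwaniec2002, §4.2 (4.12) & p. 49, PDF pp. 49, 51] -/
def heightOp (k : ℝ → ℝ) (φ : ℝ → ℂ) (y : ℝ) : ℂ :=
  if 0 < y then invariantOperator k (fun w : ℍ => φ w.im) (UpperHalfPlane.ofComplex ⟨0, y⟩) else 0

/-- `L_k` commutes with horizontal translations, so `L_k` of a function of the height is a function
of the height: `L_k(φ ∘ Im)(z) = L_k(φ ∘ Im)(i Im z)`. [cite: Iwaniec2002, §1.8 & p. 49, PDF pp. 20–21, 49] -/
theorem invariantOperator_comp_im_eq (k : ℝ → ℝ) (φ : ℝ → ℂ) (z : ℍ) :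
    invariantOperator k (fun w : ℍ => φ w.im) z =
      invariantOperator k (fun w : ℍ => φ w.im) (UpperHalfPlane.ofComplex ⟨0, z.im⟩) := by
  conv_lhs => rw [← re_vadd_ofComplex_im z, ← upperRightHom_smul, ← toGL_translSL]
  rw [← invariantOperator_comp_smul_of_mem_range k (fun w : ℍ => φ w.im) ⟨translSL z.re, rfl⟩]
  congr 1
  funext w
  rw [toGL_translSL, upperRightHom_smul, UpperHalfPlane.vadd_im]

/-- **`L_k` on a height function vanishes low in the cusp**: if `φ = 0` on `(-∞, Y]` and
`Im z · e^{R} ≤ Y` (`R = 2 arsinh √M`, `k = 0` on `[M, ∞)`), then `L_k(φ ∘ Im)(z) = 0`. [folklore] -/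
theorem invariantOperator_comp_im_eq_zero {M : ℝ} (hM : ∀ u, M ≤ u → k u = 0) {φ : ℝ → ℂ} {Y : ℝ}
    (hφ : ∀ t ≤ Y, φ t = 0) {z : ℍ} (hz : z.im * Real.exp (2 * Real.arsinh (Real.sqrt M)) ≤ Y) :
    invariantOperator k (fun w : ℍ => φ w.im) z = 0 := by
  unfold invariantOperator
  refine integral_eq_zero_of_ae (Eventually.of_forall fun w => ?_)
  simp only [Pi.zero_apply]
  by_cases hw : 2 * Real.arsinh (Real.sqrt M) < dist z w
  · rw [kernel_eq_zero_of_dist hM hw]; simp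
  · rw [hφ w.im ?_]; · simp
    have h1 := UpperHalfPlane.im_le_im_mul_exp_dist w z
    rw [dist_comm] at h1
    have h2 : z.im * Real.exp (dist z w) ≤ z.im * Real.exp (2 * Real.arsinh (Real.sqrt M)) :=
      mul_le_mul_of_nonneg_left (Real.exp_le_exp.mpr (not_lt.mp hw)) z.im_pos.le
    linarith

variable (hΓ : Γ ≤ (Matrix.SpecialLinearGroup.toGL : SL(2, ℝ) →* GL (Fin 2) ℝ).range)
  (hd : IsDiscreteSubgroup Γ) (hT : Matrix.GeneralLinearGroup.upperRightHom (1 : ℝ) ∈ Γ)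

include hΓ hd hT in
/-- **`L_k E(·|φ) = E(·|M_kφ)` at the cusp `∞`** (width one): for a test kernel `k` and a bounded
measurable profile `φ = 0` on `(-∞, Y]`, `Y > 0`, `L_k(E(·|φ))(z) = E(z|M_kφ)` with
`(M_kφ)(y) = L_k(φ ∘ Im)(iy)` — `L_k` commutes with the sum over `Γ_∞\Γ` (a finite sum on every ball)
and with the action of `Γ`, and maps functions of the height to functions of the height.
[cite: Iwaniec2002, p. 49 (the Proposition) & §4.2 (4.12), PDF pp. 49, 51] -/
theorem invariantOperator_incEis (hk : IsTestKernel k) {φ : ℝ → ℂ} (hφm : Measurable φ)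
    (hφb : ∀ T : ℝ, ∃ B, ∀ t ≤ T, ‖φ t‖ ≤ B) {Y : ℝ} (hY : 0 < Y) (hφ : ∀ t ≤ Y, φ t = 0) (z : ℍ) :
    invariantOperator k (incEis Γ φ) z = incEis Γ (heightOp k φ) z := by
  classical
  obtain ⟨M, hM0, hM⟩ := hk.eventually_zero
  set R : ℝ := 2 * Real.arsinh (Real.sqrt M) with hR
  have hR0 : 0 ≤ R := mul_nonneg zero_le_two (Real.arsinh_nonneg_iff.mpr (Real.sqrt_nonneg _))
  set Φ : ℝ → ℂ := fun y => invariantOperator k (fun w : ℍ => φ w.im) (UpperHalfPlane.ofComplex ⟨0, y⟩) with hΦ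
  -- the finitely many rows that matter on the ball `B(z, R)`
  set Y' : ℝ := Y * Real.exp (-R) with hY'
  have hY'0 : 0 < Y' := mul_pos hY (Real.exp_pos _)
  have hY'R : Y' * Real.exp R = Y := by
    rw [hY', mul_assoc, ← Real.exp_add, neg_add_cancel, Real.exp_zero, mul_one]
  have hfin : {r : rows Γ | r.1 ∈ highRows Γ z (Y' / 2)}.Finite :=
    (finite_highRows hΓ hd hT z (half_pos hY'0)).preimage Subtype.val_injective.injOn
  set S : Finset (rows Γ) := hfin.toFinset with hS
  have hlow : ∀ r : rows Γ, r ∉ S → rowIm r.1 z ≤ Y' := by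
    intro r hr
    by_contra hlt
    exact hr (by rw [hS, Set.Finite.mem_toFinset]; exact ⟨r.2, by linarith [not_le.mp hlt]⟩)
  -- on the ball, `E(w|φ)` is the finite sum over `S`
  have hball : ∀ w : ℍ, dist z w ≤ R → incEis Γ φ w = (1 / 2) * ∑ r ∈ S, φ (rowIm r.1 w) := by
    intro w hw
    unfold incEis
    congr 1
    refine tsum_eq_sum fun r hr => hφ _ ?_
    have h1 := rowIm_le_mul_exp_dist hΓ r.2 w z
    rw [dist_comm] at h1
    calc rowIm r.1 w ≤ rowIm r.1 z * Real.exp (dist z w) := h1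
      _ ≤ Y' * Real.exp R := mul_le_mul (hlow r hr) (Real.exp_le_exp.mpr hw) (Real.exp_pos _).le hY'0.le
      _ = Y := hY'R
  -- `L_k E(·|φ)(z)` as a finite sum of invariant operators
  have hterm_int : ∀ r : rows Γ, Integrable fun w : ℍ => (k (pointPairInv z w) : ℂ) * φ (rowIm r.1 w) := by
    intro r
    refine integrable_kernel_mul hk ?_ z
    rw [locallyIntegrable_iff]
    intro C hC
    obtain ⟨T, hT'⟩ := hC.exists_bound_of_continuousOn (f := fun w : ℍ => rowIm r.1 w)
      (continuous_rowIm (ne_zero_of_mem_rows r.2)).continuousOn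
    obtain ⟨B, hB⟩ := hφb T
    refine Measure.integrableOn_of_bounded (M := B) hC.measure_lt_top.ne
      ((hφm.comp (continuous_rowIm (ne_zero_of_mem_rows r.2)).measurable).aestronglyMeasurable) ?_
    filter_upwards [ae_restrict_mem hC.measurableSet] with w hw
    refine hB _ ?_
    have := hT' w hw
    rw [Real.norm_eq_abs] at this
    exact (le_abs_self _).trans this
  have hL : invariantOperator k (incEis Γ φ) z =
      (1 / 2) * ∑ r ∈ S, invariantOperator k (fun w : ℍ => φ (rowIm r.1 w)) z := by
    unfold invariantOperator
    have e : (fun w : ℍ => (k (pointPairInv z w) : ℂ) * incEis Γ φ w) =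
        fun w : ℍ => (1 / 2) * ∑ r ∈ S, (k (pointPairInv z w) : ℂ) * φ (rowIm r.1 w) := by
      funext w
      by_cases hw : dist z w ≤ R
      · rw [hball w hw, Finset.mul_sum, Finset.mul_sum, Finset.mul_sum]
        exact Finset.sum_congr rfl fun r _ => by ring
      · rw [kernel_eq_zero_of_dist hM (not_le.mp hw)]
        simp
    rw [e, integral_const_mul, integral_finsetSum _ fun r _ => hterm_int r]
  -- each term: invariance under `γ_r ∈ Γ` and under horizontal translations
  have hterm : ∀ r : rows Γ, invariantOperator k (fun w : ℍ => φ (rowIm r.1 w)) z = Φ (rowIm r.1 z) := by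
    rintro ⟨r, γ, hγ, rfl⟩
    have e : (fun w : ℍ => φ (rowIm (((γ : GL (Fin 2) ℝ) : Matrix (Fin 2) (Fin 2) ℝ) 1) w)) =
        fun w : ℍ => (fun v : ℍ => φ v.im) ((γ : GL (Fin 2) ℝ) • w) := by
      funext w
      change _ = φ (((γ : GL (Fin 2) ℝ) • w).im)
      rw [im_smul_eq_rowIm (hΓ hγ)]
    change invariantOperator k (fun w : ℍ => φ (rowIm (((γ : GL (Fin 2) ℝ) : Matrix (Fin 2) (Fin 2) ℝ) 1) w)) z =
      Φ (rowIm (((γ : GL (Fin 2) ℝ) : Matrix (Fin 2) (Fin 2) ℝ) 1) z)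
    rw [e, invariantOperator_comp_smul_of_mem_range k (fun v : ℍ => φ v.im) (hΓ hγ) z,
      invariantOperator_comp_im_eq, im_smul_eq_rowIm (hΓ hγ)]
  -- the height operator vanishes on `(-∞, Y']`
  have hΦlow : ∀ t ≤ Y', heightOp k φ t = 0 := by
    intro t ht
    unfold heightOp
    split_ifs with ht0
    · refine invariantOperator_comp_im_eq_zero hM hφ ?_
      rw [show (UpperHalfPlane.ofComplex (⟨0, t⟩ : ℂ)).im = t from by
        rw [UpperHalfPlane.ofComplex_apply_of_im_pos (z := (⟨0, t⟩ : ℂ)) ht0]; rfl]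
      calc t * Real.exp R ≤ Y' * Real.exp R := mul_le_mul_of_nonneg_right ht (Real.exp_pos _).le
        _ = Y := hY'R
    · rfl
  -- the right-hand side is the same finite sum
  have hR' : incEis Γ (heightOp k φ) z = (1 / 2) * ∑ r ∈ S, Φ (rowIm r.1 z) := by
    unfold incEis
    congr 1
    rw [tsum_eq_sum (s := S) fun r hr => hΦlow _ (hlow r hr)]
    refine Finset.sum_congr rfl fun r _ => ?_
    unfold heightOp
    rw [if_pos (rowIm_pos (ne_zero_of_mem_rows r.2) z)]
  rw [hL, hR']
  congr 1
  exact Finset.sum_congr rfl fun r _ => hterm r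

/-- The height operator vanishes on `(-∞, Y e^{-R}]` (`R = 2 arsinh √M`) if `φ = 0` on `(-∞, Y]`. [folklore] -/
theorem heightOp_eq_zero {M : ℝ} (hM : ∀ u, M ≤ u → k u = 0) {φ : ℝ → ℂ} {Y : ℝ}
    (hφ : ∀ t ≤ Y, φ t = 0) {t : ℝ} (ht : t * Real.exp (2 * Real.arsinh (Real.sqrt M)) ≤ Y) :
    heightOp k φ t = 0 := by
  unfold heightOp
  split_ifs with ht0
  · refine invariantOperator_comp_im_eq_zero hM hφ ?_
    rwa [show (UpperHalfPlane.ofComplex (⟨0, t⟩ : ℂ)).im = t from by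
      rw [UpperHalfPlane.ofComplex_apply_of_im_pos (z := (⟨0, t⟩ : ℂ)) ht0]; rfl]
  · rfl

/-- **The height operator on a lifted log-profile is the lift of the profile convolution**:
`M_k(√y Ψ(log y)) = √y (g ⋆ Ψ)(log y)` ((4.12)). [cite: Iwaniec2002, §4.2 (4.12), PDF p. 51] -/
theorem heightOp_liftProfile (hk : IsTestKernel k) {Ψ : ℝ → ℂ} (hΨm : Measurable Ψ) {B : ℝ}
    (hB : ∀ v, ‖Ψ v‖ ≤ B) : heightOp k (liftProfile 0 Ψ) = liftProfile 0 (profileConv k Ψ) := by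
  funext y
  unfold heightOp
  split_ifs with hy
  · rw [invariantOperator_liftProfile hk hΨm hB, liftProfile_eq_of_lt _ hy,
      show (UpperHalfPlane.ofComplex (⟨0, y⟩ : ℂ)).im = y from by
        rw [UpperHalfPlane.ofComplex_apply_of_im_pos (z := (⟨0, y⟩ : ℂ)) hy]; rfl]
    rfl
  · rw [liftProfile_eq_zero_of_le _ (not_lt.mp hy)]

variable {hT}
variable (hneg : (-1 : GL (Fin 2) ℝ) ∈ Γ) (σ : SL(2, ℝ))
  (hper : (ConjAct.toConjAct (Matrix.SpecialLinearGroup.toGL σ : GL (Fin 2) ℝ)⁻¹ • Γ).strictPeriods =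
    AddSubgroup.zmultiples 1)

include hΓ hd hper in
/-- **`L_k E_𝔞(·|φ) = E_𝔞(·|M_kφ)` at an arbitrary cusp** `𝔞 = σ∞` (width-one scaling), for a
bounded measurable profile `φ = 0` on `(-∞, Y]`, `Y > 0`. [cite: Iwaniec2002, p. 49 & §4.2 (4.12), PDF pp. 49, 51] -/
theorem invariantOperator_incEisCusp (hk : IsTestKernel k) {φ : ℝ → ℂ} (hφm : Measurable φ)
    (hφb : ∀ T : ℝ, ∃ B, ∀ t ≤ T, ‖φ t‖ ≤ B) {Y : ℝ} (hY : 0 < Y) (hφ : ∀ t ≤ Y, φ t = 0) (z : ℍ) :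
    invariantOperator k (incEisCusp Γ σ φ) z = incEisCusp Γ σ (heightOp k φ) z := by
  set S : GL (Fin 2) ℝ := Matrix.SpecialLinearGroup.toGL σ with hS
  set Γ' : Subgroup (GL (Fin 2) ℝ) := ConjAct.toConjAct S⁻¹ • Γ with hΓ'
  have hΓ'le : Γ' ≤ (Matrix.SpecialLinearGroup.toGL : SL(2, ℝ) →* GL (Fin 2) ℝ).range := by
    rw [hΓ', hS, ← map_inv]; exact conj_le_range hΓ σ⁻¹
  have h := invariantOperator_incEis hΓ'le (hd.conj _) (upperRightHom_one_mem_of_periods hper) hk hφm hφb hY hφ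
    (σ⁻¹ • z)
  have e : incEisCusp Γ σ φ = fun w => incEis Γ' φ (σ⁻¹ • w) := rfl
  rw [e, invariantOperator_comp_smul k (incEis Γ' φ) σ⁻¹ z, h]
  rfl

include hΓ hd hper in
/-- **`L_k` on a cusp lift is the cusp lift of the profile convolution**: for a bounded measurable
log-profile `Ψ = 0` on `(-∞, log Y]` and levels `0 < Y'`, `Y' e^{R} ≤ Y` (`R = 2 arsinh √M`,
`k = 0` on `[M, ∞)`): `L_k(V_𝔞^{(Y)}Ψ) = V_𝔞^{(Y')}(g ⋆ Ψ)` pointwise. [cite: Iwaniec2002, §4.2 (4.12), PDF p. 51] -/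
theorem invariantOperator_cuspLift (hk : IsTestKernel k) {M : ℝ} (hM : ∀ u, M ≤ u → k u = 0) (hM0 : 0 ≤ M)
    {Ψ : ℝ → ℂ} (hΨm : Measurable Ψ) {B : ℝ} (hB : ∀ v, ‖Ψ v‖ ≤ B) {Y Y' : ℝ} (hY' : 0 < Y')
    (hYY' : Y' * Real.exp (2 * Real.arsinh (Real.sqrt M)) ≤ Y) (hΨ : ∀ v ≤ Real.log Y, Ψ v = 0) (z : ℍ) :
    invariantOperator k (cuspLift Γ σ Y Ψ) z = cuspLift Γ σ Y' (profileConv k Ψ) z := by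
  have hR0 : 0 ≤ 2 * Real.arsinh (Real.sqrt M) :=
    mul_nonneg zero_le_two (Real.arsinh_nonneg_iff.mpr (Real.sqrt_nonneg _))
  have hY : 0 < Y := lt_of_lt_of_le (mul_pos hY' (Real.exp_pos _)) hYY'
  have hY'Y : Y' ≤ Y := by
    calc Y' = Y' * 1 := (mul_one _).symm
      _ ≤ Y' * Real.exp (2 * Real.arsinh (Real.sqrt M)) :=
          mul_le_mul_of_nonneg_left (Real.one_le_exp hR0) hY'.le
      _ ≤ Y := hYY'
  -- the lifted profile: vanishing and local bound
  have hlift : ∀ t ≤ Y, liftProfile 0 Ψ t = 0 := by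
    intro t ht
    by_cases ht0 : 0 < t
    · rw [liftProfile_eq_of_lt Ψ ht0, hΨ _ (Real.log_le_log ht0 ht), mul_zero]
    · exact liftProfile_eq_zero_of_le Ψ (not_lt.mp ht0)
  have hbd : ∀ T : ℝ, ∃ B', ∀ t ≤ T, ‖liftProfile 0 Ψ t‖ ≤ B' := by
    intro T
    refine ⟨Real.sqrt |T| * B, fun t ht => ?_⟩
    have hB0 : 0 ≤ B := (norm_nonneg _).trans (hB 0)
    by_cases ht0 : 0 < t
    · rw [liftProfile_eq_of_lt Ψ ht0, norm_mul, Complex.norm_real, Real.norm_eq_abs,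
        abs_of_nonneg (Real.sqrt_nonneg _)]
      refine mul_le_mul (Real.sqrt_le_sqrt (le_trans ht (le_abs_self T))) (hB _) (norm_nonneg _)
        (Real.sqrt_nonneg _)
    · rw [liftProfile_eq_zero_of_le Ψ (not_lt.mp ht0), norm_zero]; positivity
  unfold cuspLift
  rw [liftProfile_eq_liftProfile_zero hY.le hΨ,
    invariantOperator_incEisCusp hΓ hd σ hper hk (measurable_liftProfile 0 hΨm) hbd hY hlift z,
    heightOp_liftProfile hk hΨm hB, ← liftProfile_eq_liftProfile_zero hY'.le]
  intro v hv
  refine profileConv_eq_zero hM hM0 hΨ ?_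
  have h1 : Real.log Y' + 2 * Real.arsinh (Real.sqrt M) ≤ Real.log Y := by
    rw [← Real.log_exp (2 * Real.arsinh (Real.sqrt M)), ← Real.log_mul hY'.ne' (Real.exp_pos _).ne']
    exact Real.log_le_log (mul_pos hY' (Real.exp_pos _)) hYY'
  linarith

end IncEisAction

/-! ## 3. The action on the cusp isometry: `T_k V_𝔞^{(Y)} = V_𝔞^{(Y')} (g ⋆ ·)` on nice profiles -/

section OperatorAction

open _root_.MeasureTheory _root_.Set _root_.Filter
open scoped _root_.Pointwise _root_.ENNReal _root_.Topology _root_.ComplexConjugate _root_.InnerProductSpace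

variable {k : ℝ → ℝ} {F : Set ℍ}

/-- **Nice log-profiles**: bounded, measurable, supported in `(log Y, b]`. They are dense in
`L²((log Y, ∞))` and their cusp lifts are bounded automorphic functions. [folklore] -/
structure IsNiceProfile (Y b : ℝ) (Ψ : ℝ → ℂ) : Prop where
  measurable : Measurable Ψ
  bounded : ∃ B, ∀ v, ‖Ψ v‖ ≤ B
  eq_zero_of_le : ∀ v ≤ Real.log Y, Ψ v = 0
  eq_zero_of_ge : ∀ v, b ≤ v → Ψ v = 0

namespace IsNiceProfile

variable {Y b : ℝ} {Ψ : ℝ → ℂ}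

/-- The lifted profile of a nice profile is bounded. [folklore] -/
theorem norm_liftProfile_le (h : IsNiceProfile Y b Ψ) :
    ∃ B', ∀ t, ‖liftProfile Y Ψ t‖ ≤ B' := by
  obtain ⟨B, hB⟩ := h.bounded
  have hB0 : 0 ≤ B := (norm_nonneg _).trans (hB 0)
  refine ⟨Real.sqrt (Real.exp b) * B, fun t => ?_⟩
  by_cases ht : Y < t
  · rw [liftProfile_eq_of_lt Ψ ht, norm_mul, Complex.norm_real, Real.norm_eq_abs, abs_of_nonneg (Real.sqrt_nonneg _)]
    by_cases htb : Real.exp b ≤ t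
    · have hpos : 0 < t := (Real.exp_pos b).trans_le htb
      rw [h.eq_zero_of_ge _ (by rw [← Real.log_exp b]; exact Real.log_le_log (Real.exp_pos b) htb), norm_zero,
        mul_zero]
      positivity
    · exact mul_le_mul (Real.sqrt_le_sqrt (not_le.mp htb).le) (hB _) (norm_nonneg _) (Real.sqrt_nonneg _)
  · rw [liftProfile_eq_zero_of_le Ψ (not_lt.mp ht), norm_zero]; positivity

/-- A nice profile is square-integrable on `(log Y, ∞)`. [folklore] -/
theorem memLp (h : IsNiceProfile Y b Ψ) : MemLp Ψ 2 ((volume : Measure ℝ).restrict (Ioi (Real.log Y))) := by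
  obtain ⟨B, hB⟩ := h.bounded
  have hB0 : 0 ≤ B := (norm_nonneg _).trans (hB 0)
  refine memLp_two_of_lintegral_enorm_sq_ne_top h.measurable.aestronglyMeasurable.restrict ?_
  have hle : ∫⁻ v in Ioi (Real.log Y), ‖Ψ v‖ₑ ^ 2 ≤ ∫⁻ v in Icc (Real.log Y) b, ENNReal.ofReal (B ^ 2) := by
    rw [← lintegral_indicator measurableSet_Ioi, ← lintegral_indicator measurableSet_Icc]
    refine lintegral_mono fun v => ?_
    by_cases hv : v ∈ Icc (Real.log Y) b
    · rw [indicator_of_mem hv]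
      refine (indicator_le_self _ _ v).trans ?_
      rw [← ofReal_norm, ← ENNReal.ofReal_pow (norm_nonneg _)]
      exact ENNReal.ofReal_le_ofReal (pow_le_pow_left₀ (norm_nonneg _) (hB v) 2)
    · rw [indicator_of_notMem hv]
      by_cases hv' : v ∈ Ioi (Real.log Y)
      · rw [indicator_of_mem hv']
        have : Ψ v = 0 := by
          rcases not_and_or.mp hv with h1 | h1
          · exact absurd (le_of_lt hv') h1
          · exact h.eq_zero_of_ge v (not_le.mp h1).le
        simp [this]
      · rw [indicator_of_notMem hv']
  refine (lt_of_le_of_lt hle ?_).ne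
  rw [setLIntegral_const]
  exact ENNReal.mul_lt_top ENNReal.ofReal_lt_top (measure_Icc_lt_top)

/-- The profile convolution of a nice profile is nice at the level `Y'` with `Y' e^{R} ≤ Y`. [folklore] -/
theorem profileConv (h : IsNiceProfile Y b Ψ) (hk : IsTestKernel k) {M : ℝ} (hM : ∀ u, M ≤ u → k u = 0)
    (hM0 : 0 ≤ M) {Y' : ℝ} (hY' : 0 < Y') (hYY' : Y' * Real.exp (2 * Real.arsinh (Real.sqrt M)) ≤ Y) :
    IsNiceProfile Y' (b + 2 * Real.arsinh (Real.sqrt M)) (profileConv k Ψ) := by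
  obtain ⟨B, hB⟩ := h.bounded
  refine ⟨measurable_profileConv hk h.measurable, ⟨_, norm_profileConv_le hk hB⟩, ?_, ?_⟩
  · intro v hv
    refine profileConv_eq_zero hM hM0 h.eq_zero_of_le ?_
    have h1 : Real.log Y' + 2 * Real.arsinh (Real.sqrt M) ≤ Real.log Y := by
      rw [← Real.log_exp (2 * Real.arsinh (Real.sqrt M)), ← Real.log_mul hY'.ne' (Real.exp_pos _).ne']
      exact Real.log_le_log (mul_pos hY' (Real.exp_pos _)) hYY'
    linarith
  · intro v hv
    unfold _root_.Literature.NumberTheory.Automorphic.Fuchsian.profileConv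
    refine integral_eq_zero_of_ae (Eventually.of_forall fun r => ?_)
    simp only [Pi.zero_apply]
    by_cases hr : 2 * Real.arsinh (Real.sqrt M) ≤ |r|
    · rw [selbergG_eq_zero hM hM0 hr]; simp
    · rw [h.eq_zero_of_ge (v + r) (by linarith [neg_abs_le r, not_le.mp hr])]; simp

end IsNiceProfile

variable (hΓ : Γ ≤ (Matrix.SpecialLinearGroup.toGL : SL(2, ℝ) →* GL (Fin 2) ℝ).range)
  (hneg : (-1 : GL (Fin 2) ℝ) ∈ Γ) (hd : IsDiscreteSubgroup Γ) (hF : IsHypFundamentalDomain Γ F)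
  (σ : SL(2, ℝ))
  (hper : (ConjAct.toConjAct (Matrix.SpecialLinearGroup.toGL σ : GL (Fin 2) ℝ)⁻¹ • Γ).strictPeriods =
    AddSubgroup.zmultiples 1)

include hΓ hneg hd hper in
/-- The cusp lift of a nice profile is bounded, hence locally integrable (`Y ≥ 1`). [folklore] -/
theorem locallyIntegrable_cuspLift {Y b : ℝ} (hY : 1 ≤ Y) {Ψ : ℝ → ℂ} (h : IsNiceProfile Y b Ψ) :
    LocallyIntegrable (cuspLift Γ σ Y Ψ) := by
  obtain ⟨B', hB'⟩ := h.norm_liftProfile_le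
  rw [locallyIntegrable_iff]
  intro C hC
  exact Measure.integrableOn_of_bounded (M := B') hC.measure_lt_top.ne
    ((measurable_cuspLift hΓ hd σ hper (by linarith) h.measurable).aestronglyMeasurable)
    (Eventually.of_forall fun z => norm_incEisCusp_le_of_bound hΓ hneg hd σ hper hY
      (fun _ ht => liftProfile_eq_zero_of_le Ψ ht) hB' z)

include hΓ hneg hd hF hper in
/-- **`T_k` on the cusp isometry**: for a continuous test kernel `k` (`k = 0` on `[M, ∞)`), levels
`1 ≤ Y'`, `Y' e^{R} ≤ Y` (`R = 2 arsinh √M`) and a nice profile `Ψ` at level `Y`: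
`T_k (V_𝔞^{(Y)} Ψ) = V_𝔞^{(Y')} (g ⋆ Ψ)` in `L²(F)`. [cite: Iwaniec2002, §4.2 (4.12) & p. 49, PDF pp. 49, 51] -/
theorem kernelCLM_cuspIsometry (hk : IsTestKernel k) (hkc : Continuous k) {M : ℝ} (hM : ∀ u, M ≤ u → k u = 0)
    (hM0 : 0 ≤ M) {Y Y' b : ℝ} (hY' : 1 ≤ Y') (hYY' : Y' * Real.exp (2 * Real.arsinh (Real.sqrt M)) ≤ Y)
    {Ψ : ℝ → ℂ} (h : IsNiceProfile Y b Ψ) :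
    kernelCLM hΓ hneg hd hF hk hkc (cuspIsometry hΓ hneg hd hF σ hper
        (le_trans hY' (le_trans (le_mul_of_one_le_right (by linarith) (Real.one_le_exp
          (mul_nonneg zero_le_two (Real.arsinh_nonneg_iff.mpr (Real.sqrt_nonneg _))))) hYY')) (h.memLp.toLp Ψ)) =
      cuspIsometry hΓ hneg hd hF σ hper hY' ((h.profileConv hk hM hM0 (by linarith) hYY').memLp.toLp _) := by
  have hR0 : 0 ≤ 2 * Real.arsinh (Real.sqrt M) :=
    mul_nonneg zero_le_two (Real.arsinh_nonneg_iff.mpr (Real.sqrt_nonneg _))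
  have hY : 1 ≤ Y := le_trans hY' (le_trans (le_mul_of_one_le_right (by linarith) (Real.one_le_exp hR0)) hYY')
  obtain ⟨B, hB⟩ := h.bounded
  refine Lp.ext ?_
  have h1 := kernelCLM_coeFn hΓ hneg hd hF hk hkc (cuspIsometry hΓ hneg hd hF σ hper hY (h.memLp.toLp Ψ))
  have h2 := cuspIsometry_toLp_coeFn hΓ hneg hd hF σ hper hY h.measurable h.memLp
  have h3 := cuspIsometry_toLp_coeFn hΓ hneg hd hF σ hper hY' (h.profileConv hk hM hM0 (by linarith) hYY').measurable
    (h.profileConv hk hM hM0 (by linarith) hYY').memLp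
  have h4 : kernelOp Γ F k (cuspIsometry hΓ hneg hd hF σ hper hY (h.memLp.toLp Ψ)) =
      kernelOp Γ F k (cuspLift Γ σ Y Ψ) := kernelOp_congr_ae h2
  filter_upwards [h1, h3] with z hz hz'
  rw [hz, hz', h4, kernelOp_eq_invariantOperator_of_automorphic hΓ hneg hd hF hk
    (isAutomorphic_cuspLift hΓ σ Y Ψ) (locallyIntegrable_cuspLift hΓ hneg hd σ hper hY h) z,
    invariantOperator_cuspLift hΓ hd σ hper hk hM hM0 h.measurable hB (by linarith) hYY' h.eq_zero_of_le z]

end OperatorAction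

end Fuchsian

end Literature.NumberTheory.Automorphic

end
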